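import Summits.Ventures.CertifiedManyBodySolver.Downfold.PinnedPairTPrimeOfQuotChainKernelCertsRows
import Summits.Ventures.CertifiedManyBodySolver.Downfold.UPinnedPairRowKernel
import HarnessLib

/-!
# PINNED U-PAIR shape — THE «ROWS + HALVING» INPUT SHAPE ON THE BOX GEOMETRY: the U-AXIS twin of hubbard-cov-la214-box-2's
# `Downfold/PinnedPairTPrimeOfQuotChainKernelCertsRows.lean` (p685457 §1–§2), ending in hubbard-cov-hg1201-box-2's
# `SquareTTPrimePinnedPairRowU.of_residPolys_wide` (p680519)

Venture CertifiedManyBodySolver; cell `hubbard-obs` / D-0154 (1)(C) COVERAGE HgBa₂CuO₄₊δ «Hg-1201»; seat `hubbard-cov-hg1201-box-1` (g4), U-direction /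
lineage desk (the pinned U-pair shape `SquareTTPrimePinnedPairRowU` is this seat's p660744; its kernel link `…of_windowIdentities_wide` /
`…of_residPolys_wide` is hubbard-cov-hg1201-box-2 g3's p680519). One-writer rulings respected: NOTHING generic is re-typed — the half-row Gram
(`gramTBRowsHalf`, `gramTB`, `lowerTB`, `gramTBCoef_posSemidef`, `termOp_gramTB_eq_gramForm`, `termOp_flatten_gramTBRowsHalf`), the absorption identity
`termOp_residTG_gramX` and `autoMasks` / `eomFarOK_autoMasks` are hubbard-obs-p2's (p684213 / p683122); the chain kernels (`allMovesZ_ok`,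
`shiftSet_subset_of_ok`, `d_gq_of_moves`, `evalPoly_quotAdjChainNear_residTG`) and the box facts (`boxQuot`, `boxD`, `boxPush`, …) are
hubbard-cov-la214-unc-2's / hubbard-obs-p2's; the binder lists below are p685457's VERBATIM with `(U, s_A, s_B) ↦ (U_A, U_B, s)` and the last call swapped.

WHY (hubbard-cov-hg1201-box-2 g4 README «g4», successor option (i); hubbard-obs STATUS 2026-08-29T01:40:21Z): after p686635 / p686651 / p686662 the three
Hg-1201 BOTTOM (K2 `t′`-segment) items have instance-facing closers `…_of_kernelCertsRows` in hubbard-cov-la214-plan-1's design of record R-g4-5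
((N)-BY-ROWS + ADJOINT HALVING, `autoMasks`, box geometry); the three LEFT-EDGE (U-cell) items stmt-Ventures-26186 / 27755 / 27104 did not, because the
U-pair box edition had no writer (U-pairs exist only in the Hg lane). THIS FILE is that edition:
* §1 `SquareTTPrimePinnedPairRowU.of_quotAdjChainNearKernelCertsGX_wide` — wide window `Λ' ⊇ box 2 7`, explicit eom masks, per vertex chain slices
  `TGs` + named PSD Gram `TGf` + anti-Hermitian remainder `V`;
* §2 `SquareTTPrimePinnedPairRowU.of_quotAdjChainKernelCertsTBRowsHalfAuto_box (r R vmax) (7 ≤ R) (r+1 ≤ R) (r+vmax ≤ R) …` — THE INSTANCE-FACING U-PAIR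
  THEOREM FOR THE DESIGN OF RECORD: geometry discharged; per vertex ONLY `TH hH TE hE TX hX μ ν κ cap κ' fl K blocks CW hcw AV ns M Cs hC0 Hs hchain hβ hsl`.
Consumers: `Theorems/CovHg1201{M19b,M19,M19P10}LeftEdgeOfKernelCertsRows.lean` (this seat; the left-edge items from THREE box certificates {P, Q, R} —
two U-pairs sharing the middle vertex — through hubbard-cov-hg1201-box-2 g3's `…_PatchLeftEdge*_of_pairU_twoCells`).

EFFECT: a U-pair instance emitted under R-g4-5 for an Hg-1201 U-cell composes with NO further generic Lean. Instantiated by NO certificate: no Hg-1201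
exporter output exists (kit-side, not ordered); the (β0)/(β2) tier-P probes of 2026-08-29 are INSTRUMENT class and «no Lean proposal comes out of (β2)»
(captain hubbard-cov-hg1201-plan-1, hubbard-obs STATUS 2026-08-29T00:33:51Z); TARGETS in the design of record AS OF 2026-08-29 — if that design revs,
this file is not re-cut by this programme (a later seat re-targets on a captain word). HONEST FRAMING: Lean plumbing; evaluates nothing, discharges NO
claim node; closers of record (p642666 / p669632 / p676848), leaves (p644455 / p669917 / p677463), registry rows, tiers, margins and the pen HOLDs on
stmt-Ventures-26186 / 27755 / 27104 are UNCHANGED; «closed modulo nodes» ≠ proved; CONTROL / CALIBRATION class (wording (xx1)): one-sided stiffness-scale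
ceilings of a downfolded screening-grade one-band Hg-1201-labelled box; a ceiling never speaks to the presence of superconductivity or to `ρ_s = 0`; no
`T_c` / phase / pressure sentence (the @0 / @10 columns are certified separately); nothing about HgBa₂CuO₄₊δ samples; no item, rung leaf or summit statement
is proved here. Zero compute, no definition, no `sorry`.

References: X. Han, arXiv:2006.06002, §3 [cite: Han2020Bootstrap, §3]; J. Wang et al., PRX 14 (2024) 031006, §III [cite: WangEtAl2024, §III]; C. Jansson,
D. Chaykin, C. Keil, SIAM J. Numer. Anal. 46 (2008) 180, §3 [cite: JanssonChaykinKeil2008, §3]; O. Bratteli, D. W. Robinson, *OAQSM 2*, §5.2.2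
[cite: BratteliRobinsonII1997, §5.2.2]; S. Boyd, L. Vandenberghe, *Convex Optimization* (2004) §5.9 [cite: BoydVandenberghe2004, §5.9].
-/

noncomputable section

namespace Summit.Ventures.CertifiedManyBodySolver.Downfold

open Literature.MathematicalPhysics.QuantumLattice
open Matrix HubbardWave0 Literature.Probability.LatticeModels ThermodynamicLimit Filter Topology
open Literature.MathematicalPhysics.QuantumManyBody.StateRelaxation
open Summit.Ventures.CertifiedQuantumChemistry Summit.Ventures.CertifiedQuantumChemistry.CARPoly
open Summit.Ventures.CertifiedManyBodySolver.CARPolyWindow Summit.Ventures.CertifiedManyBodySolver.CARPolyWindow.BoxGeom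
open Summit.Ventures.CertifiedManyBodySolver.Observables
open scoped BigOperators ComplexOrder

/-! ## §1 The wide U-pair consumer with an anti-Hermitian Gram remainder (explicit eom masks) -/

section GXWide

variable {N Nβ : ℕ} [NeZero N]

/-- **PINNED U-PAIR SHAPE FROM TWO `stepEQA` CHAINS WHOSE GRAM SLICES DENOTE `G − V + Vᴴ`** (wide window `Λ' ⊇ box 2 7`, explicit eom masks):
the U-AXIS twin of hubbard-cov-la214-box-2's `TPrimePinnedPairFamilyRowWN.of_quotAdjChainNearKernelCertsGX_wide` (p685457 §1) — SAME binder list with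
`(U, s_A, s_B) ↦ (U_A, U_B, s)`: the two vertices are issued at `(1, s, U_A)` and `(1, s, U_B)` (same `t′ = s`), ONE shared eom word list `EB`, the SAME
objective word `X` at both vertices; per vertex the chain slices `TGs_v`, a named term `TGf_v` denoting a PSD `gramForm Λm_v O_v` and a remainder generator
`V_v` with `hG_v : termOp d TGs_v.flatten = termOp d TGf_v − termOp d V_v + (termOp d V_v)ᴴ`. Proof = p685457 §1's lines (hubbard-cov-la214-unc-2's chain
kernels, hubbard-obs-p2's `termOp_residTG_gramX`) with the last call swapped to hubbard-cov-hg1201-box-2's `SquareTTPrimePinnedPairRowU.of_residPolys_wide`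
(p680519); the box slope convention `sl_v = (μ_v 0 + μ_v 1)/2` is bridged to that consumer's `μ_v 0 + μ_v 1 = 2·sl_v` in-proof.
[cite: Han2020Bootstrap, §3] [cite: WangEtAl2024, §III] [cite: JanssonChaykinKeil2008, §3] [cite: BratteliRobinsonII1997, §5.2.2] -/
theorem SquareTTPrimePinnedPairRowU.of_quotAdjChainNearKernelCertsGX_wide
    (UA : ℚ) (hUA : 0 ≤ UA) (UB s n₀ : ℚ)
    {Λ Λ' : Finset (Site 2)} (h7 : Literature.Probability.LatticeModels.box 2 7 ⊆ Λ') (hΛ : Λ ⊆ Λ') (h8 : thicken Λ 1 ⊆ Λ')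
    (h0 : thicken ({0} : Finset (Site 2)) 1 ⊆ Λ') (hz : (0 : Site 2) ∈ Λ')
    (D : QuotData N Nβ) (hxs : ∀ i, D.xs i ∈ Λ') (hix : ∀ y ∈ Λ', D.xs (D.ix y) = y)
    (hxsβ : ∀ j, D.xsβ j ∈ Λ) (hcovβ : ∀ x ∈ Λ, ∃ j, D.xsβ j = x)
    (d : Orb (Fin N) → Orb (PolySite Λ')) (hd : Function.Injective d)
    (hdx : ∀ i σ, d (orb i σ) = orb (PolySite.pt (D.xs i) (hxs i)) σ) (Bkey : ℕ)
    (dΛ : Orb (Fin Nβ) → Orb (PolySite Λ)) (hdΛ : ∀ j σ, dΛ (orb j σ) = orb (PolySite.pt (D.xsβ j) (hxsβ j)) σ)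
    (hf : ∀ b, d (D.f b) = Orb.embMap (PolySite.incl hΛ) (dΛ b))
    (sp : Orb (Fin N) → Fin 2) (hsp : ∀ a, (ofLex (d a)).2 = sp a)
    (hokV : ∀ γc v, D.ok γc v = true →
      ∀ j : Fin Nβ, D.xs (D.ix (d4Vec (d4OfCode γc) (D.xsβ j) + siteOfPair v)) = d4Vec (d4OfCode γc) (D.xsβ j) + siteOfPair v)
    (o : Fin 2 → Orb (Fin N)) (ho : ∀ σ, d (o σ) = orb (PolySite.pt 0 hz) σ)
    (X : FermionOp (Literature.Probability.LatticeModels.box 2 7)) (EB : List (Terms (Orb (Fin Nβ))))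
    -- vertex A
    (THA : Terms (Orb (Fin N)))
    (hHA : termOp d THA = (hubbardTTPrimeFermionInteraction 1 (s : ℝ) (UA : ℝ)).localHamiltonian Λ')
    (TEA : Terms (Orb (Fin N)))
    (hEA : termOp d TEA = fermionEmbed (PolySite.incl h0) ((hubbardTTPrimeFermionInteraction 1 (s : ℝ) (UA : ℝ)).meanEnergyObs 1))
    (TXA : Terms (Orb (Fin N))) (hXA : termOp d TXA = fermionEmbed (PolySite.incl h7) X) (μA : Fin 2 → ℚ) (νA κA capA κA' flA : ℚ)
    (TGsA : List (Terms (Orb (Fin N)))) (TGfA VA : Terms (Orb (Fin N)))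
    {mA : Type*} [Fintype mA] [DecidableEq mA] {ΛmA : Matrix mA mA ℂ} (hΛmA : ΛmA.PosSemidef)
    (OA : mA → FermionOp Λ') (hTGfA : termOp d TGfA = gramForm ΛmA OA)
    (hGA : termOp d TGsA.flatten = termOp d TGfA - termOp d VA + (termOp d VA)ᴴ)
    (CWA : Terms (Orb (Fin N))) (hcwA : ∀ wc ∈ CWA, chargeW wc.1 ≠ 0 ∨ spinChargeW sp wc.1 ≠ 0) (AVA : List (Terms (Orb (Fin N))))
    (masksA : List (List Bool)) (hfarA : eomFarOK THA D.f EB masksA = true)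
    (nsA : List ℕ) (MA : ℕ) (CsA : List SOSDual.EncPoly) (hC0A : CsA.getD 0 [] = []) (HsA : List (List (QHint Nβ)))
    (hchainA : ChainQAOK D Bkey MA CsA
      (groupSlices (residTGslicesNear TXA μA νA o κA capA κA' flA TEA TGsA THA D.f EB masksA
        (fun l : Fin 0 => l.elim0) (fun l : Fin 0 => l.elim0) CWA AVA) nsA) HsA)
    {βA : ℚ} (hβA : βA ≤ lowerConst (SOSDual.decPoly N (CsA.getD MA [])) + (μA 0 + μA 1) * (n₀ / 2 - νA))
    {slA : ℚ} (hslA : slA = (μA 0 + μA 1) / 2)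
    -- vertex B
    (THB : Terms (Orb (Fin N)))
    (hHB : termOp d THB = (hubbardTTPrimeFermionInteraction 1 (s : ℝ) (UB : ℝ)).localHamiltonian Λ')
    (TEB : Terms (Orb (Fin N)))
    (hEB : termOp d TEB = fermionEmbed (PolySite.incl h0) ((hubbardTTPrimeFermionInteraction 1 (s : ℝ) (UB : ℝ)).meanEnergyObs 1))
    (TXB : Terms (Orb (Fin N))) (hXB : termOp d TXB = fermionEmbed (PolySite.incl h7) X) (μB : Fin 2 → ℚ) (νB κB capB κB' flB : ℚ)
    (TGsB : List (Terms (Orb (Fin N)))) (TGfB VB : Terms (Orb (Fin N)))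
    {mB : Type*} [Fintype mB] [DecidableEq mB] {ΛmB : Matrix mB mB ℂ} (hΛmB : ΛmB.PosSemidef)
    (OB : mB → FermionOp Λ') (hTGfB : termOp d TGfB = gramForm ΛmB OB)
    (hGB : termOp d TGsB.flatten = termOp d TGfB - termOp d VB + (termOp d VB)ᴴ)
    (CWB : Terms (Orb (Fin N))) (hcwB : ∀ wc ∈ CWB, chargeW wc.1 ≠ 0 ∨ spinChargeW sp wc.1 ≠ 0) (AVB : List (Terms (Orb (Fin N))))
    (masksB : List (List Bool)) (hfarB : eomFarOK THB D.f EB masksB = true)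
    (nsB : List ℕ) (MB : ℕ) (CsB : List SOSDual.EncPoly) (hC0B : CsB.getD 0 [] = []) (HsB : List (List (QHint Nβ)))
    (hchainB : ChainQAOK D Bkey MB CsB
      (groupSlices (residTGslicesNear TXB μB νB o κB capB κB' flB TEB TGsB THB D.f EB masksB
        (fun l : Fin 0 => l.elim0) (fun l : Fin 0 => l.elim0) CWB AVB) nsB) HsB)
    {βB : ℚ} (hβB : βB ≤ lowerConst (SOSDual.decPoly N (CsB.getD MB [])) + (μB 0 + μB 1) * (n₀ / 2 - νB))
    {slB : ℚ} (hslB : slB = (μB 0 + μB 1) / 2) :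
    SquareTTPrimePinnedPairRowU (UA : ℝ) (UB : ℝ) (s : ℝ) capA capB flA flB βA κA κA' slA βB κB κB' slB n₀
      Finset.univ (Literature.Probability.LatticeModels.box 2 7) X := by
  -- the accepted move lists of the two chains
  set LA := allMovesZ D Bkey (groupSlices (residTGslicesNear TXA μA νA o κA capA κA' flA TEA TGsA THA D.f EB masksA
    (fun l : Fin 0 => l.elim0) (fun l : Fin 0 => l.elim0) CWA AVA) nsA) HsA MA with hLA
  set LB := allMovesZ D Bkey (groupSlices (residTGslicesNear TXB μB νB o κB capB κB' flB TEB TGsB THB D.f EB masksB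
    (fun l : Fin 0 => l.elim0) (fun l : Fin 0 => l.elim0) CWB AVB) nsB) HsB MB with hLB
  -- every accepted move is licensed ⇒ geometry of the rebuilt families from the tables
  have hokA : ∀ mv ∈ LA, D.ok mv.1 mv.2.1 = true := allMovesZ_ok D Bkey _ HsA MA
  have hokB : ∀ mv ∈ LB, D.ok mv.1 mv.2.1 = true := allMovesZ_ok D Bkey _ HsB MB
  have hshA : ∀ l : Fin LA.length, d4ShiftSet (d4OfCode (LA.get l).1) (siteOfPair (LA.get l).2.1) Λ ⊆ Λ' :=
    shiftSet_subset_of_ok D hxs hcovβ hokV LA hokA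
  have hshB : ∀ l : Fin LB.length, d4ShiftSet (d4OfCode (LB.get l).1) (siteOfPair (LB.get l).2.1) Λ ⊆ Λ' :=
    shiftSet_subset_of_ok D hxs hcovβ hokV LB hokB
  have hgA := d_gq_of_moves D hxs d hdx hix hxsβ dΛ hdΛ LA hshA
  have hgB := d_gq_of_moves D hxs d hdx hix hxsβ dΛ hdΛ LB hshB
  -- the SEMANTIC residuals WITH the accepted families …
  have hRA := evalPoly_quotAdjChainNear_residTG hd D Bkey TXA μA νA o κA capA κA' flA TEA TGsA THA EB masksA hfarA
    CWA AVA nsA MA CsA hC0A HsA hchainA LA hLA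
  have hRB := evalPoly_quotAdjChainNear_residTG hd D Bkey TXB μB νB o κB capB κB' flB TEB TGsB THB EB masksB hfarB
    CWB AVB nsB MB CsB hC0B HsB hchainB LB hLB
  -- … with the Gram remainders moved into the adjoint families (hubbard-obs-p2's `termOp_residTG_gramX`)
  rw [termOp_residTG_gramX d TXA μA νA o κA capA κA' flA TEA TGsA.flatten TGfA VA hGA THA D.f EB _ _ CWA _] at hRA
  rw [termOp_residTG_gramX d TXB μB νB o κB capB κB' flB TEB TGsB.flatten TGfB VB hGB THB D.f EB _ _ CWB _] at hRB
  -- the slope convention of the U-pair consumer (`Σμ = 2·sl`) from the box convention (`sl = Σμ/2`)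
  have hslA' : μA 0 + μA 1 = 2 * slA := by rw [hslA]; ring
  have hslB' : μB 0 + μB 1 = 2 * slB := by rw [hslB]; ring
  exact SquareTTPrimePinnedPairRowU.of_residPolys_wide UA hUA UB s n₀ h7 hΛ h8 h0 hz d dΛ D.f hf sp hsp o ho X EB
    THA hHA TEA hEA TXA hXA μA νA κA capA κA' flA TGfA hΛmA OA hTGfA _ _ hshA _ hgA _ CWA hcwA _ hRA hβA hslA'
    THB hHB TEB hEB TXB hXB μB νB κB capB κB' flB TGfB hΛmB OB hTGfB _ _ hshB _ hgB _ CWB hcwB _ hRB hβB hslB'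

end GXWide

/-! ## §2 THE BOX EDITION over `gramTBRowsHalf` with kernel-computed eom masks — the instance-facing U-pair theorem for the design of record -/

section RowsHalfBox

/-- **PINNED U-PAIR SHAPE, «ROWS + HALVING» DESIGN OF RECORD, ON THE BOX GEOMETRY** — the instance-facing U-pair theorem: `D := boxQuot r R vmax`,
`Λ := boxW r ⊆ Λ' := boxW R`, letters `boxD`, push `boxPush r R`, origin letters `orb (boxIx R 0) σ`; per vertex the chain runs over
`residTGslicesNear … (gramTBRowsHalf K_v blocks_v) TH_v (boxPush r R) EB (autoMasks TH_v (boxPush r R) EB) …`; PSD-ness of the two-level coefficient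
matrix, the anti-Hermitian remainder `lowerTB` and the eom far check are discharged HERE by the same tree facts p685457 §2 uses (`gramTBCoef_posSemidef`,
`termOp_gramTB_eq_gramForm`, `termOp_flatten_gramTBRowsHalf`, `eomFarOK_autoMasks`). Per vertex the instance supplies ONLY
`TH hH TE hE TX hX μ ν κ cap κ' fl K blocks CW hcw AV ns M Cs hC0 Hs hchain hβ hsl` (vertex A at `U = U_A`, vertex B at `U = U_B`, same `s`, ONE `Bkey`,
ONE shared `EB`, SAME objective word `X₀`) ⟹ `SquareTTPrimePinnedPairRowU U_A U_B s … n₀ univ (box 2 7) X₀` (hubbard-cov-hg1201-box-1 p660744).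
[cite: Han2020Bootstrap, §3] [cite: WangEtAl2024, §III] [cite: JanssonChaykinKeil2008, §3] -/
theorem SquareTTPrimePinnedPairRowU.of_quotAdjChainKernelCertsTBRowsHalfAuto_box
    (r R vmax : ℕ) (h7R : 7 ≤ R) (hrR : r + 1 ≤ R) (hvR : r + vmax ≤ R)
    (UA : ℚ) (hUA : 0 ≤ UA) (UB s n₀ : ℚ) (Bkey : ℕ)
    (X₀ : FermionOp (Literature.Probability.LatticeModels.box 2 7)) (EB : List (Terms (Orb (Fin (boxN r)))))
    -- vertex A
    (THA : Terms (Orb (Fin (boxN R))))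
    (hHA : termOp (boxD R) THA = (hubbardTTPrimeFermionInteraction 1 (s : ℝ) (UA : ℝ)).localHamiltonian (boxW R))
    (TEA : Terms (Orb (Fin (boxN R))))
    (hEA : termOp (boxD R) TEA =
      fermionEmbed (PolySite.incl (thicken01_subset_boxW (le_trans (by norm_num) h7R)))
        ((hubbardTTPrimeFermionInteraction 1 (s : ℝ) (UA : ℝ)).meanEnergyObs 1))
    (TXA : Terms (Orb (Fin (boxN R)))) (hXA : termOp (boxD R) TXA = fermionEmbed (PolySite.incl (box_subset_boxW h7R)) X₀)
    (μA : Fin 2 → ℚ) (νA κA capA κA' flA : ℚ) (KA : ℕ) (blocksA : List (List (List ℤ × Terms (Orb (Fin (boxN R))))))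
    (CWA : Terms (Orb (Fin (boxN R)))) (hcwA : ∀ wc ∈ CWA, chargeW wc.1 ≠ 0 ∨ spinChargeW (fun a => (ofLex a).2) wc.1 ≠ 0)
    (AVA : List (Terms (Orb (Fin (boxN R)))))
    (nsA : List ℕ) (MA : ℕ) (CsA : List SOSDual.EncPoly) (hC0A : CsA.getD 0 [] = []) (HsA : List (List (QHint (boxN r))))
    (hchainA : ChainQAOK (boxQuot r R vmax) Bkey MA CsA
      (groupSlices (residTGslicesNear TXA μA νA (fun σ => orb (boxIx R 0) σ) κA capA κA' flA TEA (gramTBRowsHalf KA blocksA) THA (boxPush r R) EB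
        (autoMasks THA (boxPush r R) EB) (fun l : Fin 0 => l.elim0) (fun l : Fin 0 => l.elim0) CWA AVA) nsA) HsA)
    {βA : ℚ}
    (hβA : haveI := neZero_boxN R; βA ≤ lowerConst (SOSDual.decPoly (boxN R) (CsA.getD MA [])) + (μA 0 + μA 1) * (n₀ / 2 - νA))
    {slA : ℚ} (hslA : slA = (μA 0 + μA 1) / 2)
    -- vertex B
    (THB : Terms (Orb (Fin (boxN R))))
    (hHB : termOp (boxD R) THB = (hubbardTTPrimeFermionInteraction 1 (s : ℝ) (UB : ℝ)).localHamiltonian (boxW R))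
    (TEB : Terms (Orb (Fin (boxN R))))
    (hEB : termOp (boxD R) TEB =
      fermionEmbed (PolySite.incl (thicken01_subset_boxW (le_trans (by norm_num) h7R)))
        ((hubbardTTPrimeFermionInteraction 1 (s : ℝ) (UB : ℝ)).meanEnergyObs 1))
    (TXB : Terms (Orb (Fin (boxN R)))) (hXB : termOp (boxD R) TXB = fermionEmbed (PolySite.incl (box_subset_boxW h7R)) X₀)
    (μB : Fin 2 → ℚ) (νB κB capB κB' flB : ℚ) (KB : ℕ) (blocksB : List (List (List ℤ × Terms (Orb (Fin (boxN R))))))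
    (CWB : Terms (Orb (Fin (boxN R)))) (hcwB : ∀ wc ∈ CWB, chargeW wc.1 ≠ 0 ∨ spinChargeW (fun a => (ofLex a).2) wc.1 ≠ 0)
    (AVB : List (Terms (Orb (Fin (boxN R)))))
    (nsB : List ℕ) (MB : ℕ) (CsB : List SOSDual.EncPoly) (hC0B : CsB.getD 0 [] = []) (HsB : List (List (QHint (boxN r))))
    (hchainB : ChainQAOK (boxQuot r R vmax) Bkey MB CsB
      (groupSlices (residTGslicesNear TXB μB νB (fun σ => orb (boxIx R 0) σ) κB capB κB' flB TEB (gramTBRowsHalf KB blocksB) THB (boxPush r R) EB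
        (autoMasks THB (boxPush r R) EB) (fun l : Fin 0 => l.elim0) (fun l : Fin 0 => l.elim0) CWB AVB) nsB) HsB)
    {βB : ℚ}
    (hβB : haveI := neZero_boxN R; βB ≤ lowerConst (SOSDual.decPoly (boxN R) (CsB.getD MB [])) + (μB 0 + μB 1) * (n₀ / 2 - νB))
    {slB : ℚ} (hslB : slB = (μB 0 + μB 1) / 2) :
    SquareTTPrimePinnedPairRowU (UA : ℝ) (UB : ℝ) (s : ℝ) capA capB flA flB βA κA κA' slA βB κB κB' slB n₀
      Finset.univ (Literature.Probability.LatticeModels.box 2 7) X₀ := by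
  haveI : NeZero (boxN R) := neZero_boxN R
  have hrR' : r ≤ R := by omega
  exact SquareTTPrimePinnedPairRowU.of_quotAdjChainNearKernelCertsGX_wide UA hUA UB s n₀ (box_subset_boxW h7R) (boxW_mono hrR')
    (thicken_boxW_subset_boxW hrR) (thicken01_subset_boxW (le_trans (by norm_num) h7R)) (zero_mem_boxW R)
    (boxQuot r R vmax) (boxXs_mem R) (fun y hy => boxXs_boxIx R y hy) (boxXs_mem r) (boxQuot_hcovβ r R vmax)
    (boxD R) (boxD_injective R) (boxD_orb R) Bkey (boxD r) (boxQuot_hdΛ r R vmax) (fun b => boxD_boxPush hrR' b)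
    (fun a => (ofLex a).2) (boxD_spin R) (fun γc v hok j => box_hokV hvR γc v hok j) (fun σ => orb (boxIx R 0) σ) (boxD_orb_boxIx_zero R) X₀ EB
    THA hHA TEA hEA TXA hXA μA νA κA capA κA' flA (gramTBRowsHalf KA blocksA) (gramTB KA blocksA) (lowerTB KA blocksA)
    (gramTBCoef_posSemidef KA blocksA) (gramTBOp (boxD R) blocksA) (termOp_gramTB_eq_gramForm (boxD R) KA blocksA)
    (termOp_flatten_gramTBRowsHalf (boxD R) KA blocksA) CWA hcwA AVA (autoMasks THA (boxPush r R) EB) (eomFarOK_autoMasks THA (boxPush r R) EB)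
    nsA MA CsA hC0A HsA hchainA hβA hslA
    THB hHB TEB hEB TXB hXB μB νB κB capB κB' flB (gramTBRowsHalf KB blocksB) (gramTB KB blocksB) (lowerTB KB blocksB)
    (gramTBCoef_posSemidef KB blocksB) (gramTBOp (boxD R) blocksB) (termOp_gramTB_eq_gramForm (boxD R) KB blocksB)
    (termOp_flatten_gramTBRowsHalf (boxD R) KB blocksB) CWB hcwB AVB (autoMasks THB (boxPush r R) EB) (eomFarOK_autoMasks THB (boxPush r R) EB)
    nsB MB CsB hC0B HsB hchainB hβB hslB

end RowsHalfBox

end Summit.Ventures.CertifiedManyBodySolver.Downfold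

end
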